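import Summits.QuantumAdvantage.AdviceFreeQNC0.R1CoDegreeTolerance39
import Summits.QuantumAdvantage.AdviceFreeQNC0.LinJunta39
import HarnessLib

/-!
# Cell qa-qnc0, `p = 3` — the STRUCTURED BRANCH of (J3)_{r=1} is UNCONDITIONAL FOR EVERY READ FAMILY under a seed schedule with
# `o(N)` slack (prover qn-prover-3 g27; sequel of `R1CoDegreeTolerance39` / `R1CoDegree39` / `LinJunta39` / `GradedSeeds38Targets`)

The structured branch `GradedSeeds38.SeedJuntaHardXS` (graded-spread seeds ⊕ `(log₂N)^C`-juntas outside a tolerance set `W`) is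
conditional on (R1) `TwistedJunta36.TwistedJuntaBoundX3S` only through the DENSE-OVERLAP regime of the outside reads (PROVER3-MEMO-gen26
§2: the fibre method proves (R1) up to the cap number of the read family; `R1CoDegree39` covers co-read degree `< (log₂N)^C`).
`R1CoDegreeTolerance39` observed that EVERY read family enters the co-degree class after enlarging `W` by the few letters of large
co-degree (`≤ Σ_k #(T k ∖ W)²/t` letters for threshold `t`), and left open whether the seeds survive the enlargement.  They do, with no
re-run of Lemma S, as soon as the seed schedule carries an additive slack of the size of the enlargement: the SAME seeds, the SAME juntas
and the SAME tolerance-set budget argument go through with `W' := W ∪ {high co-degree letters}` chosen INSIDE the proof.  Hence: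

* §1 **`GradedSeeds38.exists_gradedSeedsOff`** — Lemma S (`exists_gradedSeeds`) relative to a tolerance set `W` (any field): a maximal
  injective seed sequence graded-spread OUTSIDE `W`, every form = seed combination + remainder with `< w R` non-zero coefficients OUTSIDE `W`
  (puncture the coordinates of `W` and apply Lemma S); `LinJunta39.exists_seedDecompositionOff` — the same in the (J3) vocabulary
  (`GradedSpreadOff`, `suppOff`, the identity `ℓ_k = Σ_j a_{kj} c_j + r_k`), and `exists_seedDecompositionOff_slack` for the schedule below.
* §2 ★ **`GradedSeeds38.seedJuntaHardXS_slack`** — for every `E`: ONE `θ < 1` such that for every `C` there are `D, n₀` with: seeds `c`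
  graded-spread outside `W` with schedule `N/(log₂N)^E + (log₂N)^{2C+E}·(50(j+1) + D·log₂N)`, tolerance budget `3·#W + 3·N/(log₂N)^E ≤ N`,
  juntas `H k (seed residues) x` reading `T k` with `#(T k ∖ W) ≤ (log₂N)^C` — ARBITRARY overlaps, multiplicities and co-degrees — win the
  `p = 3` ring game on `≤ θ·2^{N−1}` odd inputs.  UNCONDITIONAL (no (R1)): `AffBells22.exists_coDegree_tolerance` with `t = (log₂N)^{2C+E}` adds
  `≤ N/(log₂N)^E` letters to `W`; the slack absorbs them in the spread (`card_filter_notMem_le`) and in the budget; then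
  `GradedSeeds38.seedJuntaHardXS_of_coDegree` at level `2C + E`.
* §3 ★ **`LinJunta39.perOutputForms_structured_slack`** — the (J3)_{r=1} form: outputs `G k (⟨ℓ_k, x⟩ mod 3)` with ANY decomposition
  `ℓ_k = Σ_j a_{kj} c_j + r_k`, `c` graded-spread outside `W` (slack schedule), `#(supp r_k ∖ W) ≤ (log₂N)^C`: `≤ θ·2^{N−1}` winning odd inputs,
  UNCONDITIONALLY; with §1 this is the structured half of the (J3)_{r=1} dichotomy (ROUND-37 §3.1) relative to any tolerance set, for
  every remainder-support family — the residual regime of (R1) is traded for the `o(N)` slack `N/(log₂N)^E` in the schedule and the budget.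

What (R1) in the dense-overlap regime would still buy: the slack-free schedule `(log₂N)^C·(α(j+1) + D·log₂N)` and the budget `3·#W ≤ N`
(i.e. which families count as "structured" at small top index).  WHAT THIS IS NOT: nothing on the heavy-remainder case (B) of the dichotomy
(the residual core, ROUND-37 §4 / p2's decimation theorems); (R1) itself untouched; crux `stmt-QuantumAdvantage-22907` untouched; no ledger
item (D-0168 shelf).
-/

noncomputable section

namespace Summit.QuantumAdvantage.AdviceFreeQNC0

open Finset Literature.Computability.QuantumComplexity Literature.Computability.MetaComplexity

/-! ## §1 Lemma S relative to a tolerance set -/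

namespace GradedSeeds38

section GreedyOff

variable {F : Type*} [Field F] [DecidableEq F] {κ ι : Type*} [Fintype κ] [DecidableEq κ] [Fintype ι] [DecidableEq ι]

/-- **Greedy graded seeds OUTSIDE a tolerance set** (Lemma S `exists_gradedSeeds` applied to the forms punctured at `W`).  For every
family of forms `lam : κ → (ι → F)`, every `W ⊆ ι` and every positive schedule `w`, there is an injective seed sequence `s : Fin R → κ`
which is `w`-graded-spread counted OUTSIDE `W` (every combination with top seed `j` has `≥ w j` non-zero coefficients off `W`) and
maximal: every form of the family is a combination of the seeds plus a remainder with `< w R` non-zero coefficients off `W`. -/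
theorem exists_gradedSeedsOff (W : Finset ι) (lam : κ → ι → F) (w : ℕ → ℕ) (hw : ∀ n, 0 < w n) :
    ∃ (R : ℕ) (s : Fin R → κ), Function.Injective s ∧
      (∀ (γ : Fin R → F) (j : Fin R), γ j ≠ 0 → (∀ i, j < i → γ i = 0) →
        w j.val ≤ (univ.filter fun m : ι => m ∉ W ∧ ∑ i, γ i * lam (s i) m ≠ 0).card) ∧
      ∀ k : κ, ∃ a : Fin R → F,
        (univ.filter fun m : ι => m ∉ W ∧ lam k m - ∑ i, a i * lam (s i) m ≠ 0).card < w R := by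
  classical
  -- puncture the coordinates of `W`
  set lam' : κ → ι → F := fun k m => if m ∈ W then 0 else lam k m with hlam'
  obtain ⟨R, s, hs, hsp, hrem⟩ := exists_gradedSeeds lam' w hw
  have hval : ∀ (k : κ) (m : ι), lam' k m = if m ∈ W then 0 else lam k m := fun k m => rfl
  have hcomb : ∀ (γ : Fin R → F) (m : ι),
      ∑ i, γ i * lam' (s i) m = if m ∈ W then 0 else ∑ i, γ i * lam (s i) m := by
    intro γ m
    by_cases hm : m ∈ W
    · rw [if_pos hm]
      exact sum_eq_zero fun i _ => by rw [hval, if_pos hm, mul_zero]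
    · rw [if_neg hm]
      exact sum_congr rfl fun i _ => by rw [hval, if_neg hm]
  refine ⟨R, s, hs, ?_, ?_⟩
  · intro γ j hj habove
    have h := hsp γ j hj habove
    have hset : (univ.filter fun m : ι => ∑ i, γ i * lam' (s i) m ≠ 0)
        = univ.filter fun m : ι => m ∉ W ∧ ∑ i, γ i * lam (s i) m ≠ 0 := by
      refine filter_congr fun m _ => ?_
      rw [hcomb]
      by_cases hm : m ∈ W
      · simp [hm]
      · simp [hm]
    rw [hset] at h
    exact h
  · intro k
    obtain ⟨a, ha⟩ := hrem k
    refine ⟨a, ?_⟩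
    have hset : (univ.filter fun m : ι => lam' k m - ∑ i, a i * lam' (s i) m ≠ 0)
        = univ.filter fun m : ι => m ∉ W ∧ lam k m - ∑ i, a i * lam (s i) m ≠ 0 := by
      refine filter_congr fun m _ => ?_
      rw [hcomb, hval]
      by_cases hm : m ∈ W
      · simp [hm]
      · simp [hm]
    rw [hset] at ha
    exact ha

end GreedyOff

/-- Spread counted outside a LARGER tolerance set loses at most the number of added letters:
`#{m ∉ W : p m} ≤ #{m ∉ W' : p m} + (#W' − #W)` for `W ⊆ W'`. -/
theorem card_filter_notMem_le {N : ℕ} {W W' : Finset (Fin N)} (hWW' : W ⊆ W') (p : Fin N → Prop) [DecidablePred p] :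
    (univ.filter fun m : Fin N => m ∉ W ∧ p m).card
      ≤ (univ.filter fun m : Fin N => m ∉ W' ∧ p m).card + (W'.card - W.card) := by
  have hsub : (univ.filter fun m : Fin N => m ∉ W ∧ p m)
      ⊆ (univ.filter fun m : Fin N => m ∉ W' ∧ p m) ∪ (W' \ W) := by
    intro m hm
    rw [mem_filter] at hm
    by_cases hm' : m ∈ W'
    · exact mem_union_right _ (mem_sdiff.mpr ⟨hm', hm.2.1⟩)
    · exact mem_union_left _ (mem_filter.mpr ⟨mem_univ _, hm', hm.2.2⟩)
  have hsd : (W' \ W).card + W.card = W'.card := card_sdiff_add_card_eq_card hWW'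
  calc (univ.filter fun m : Fin N => m ∉ W ∧ p m).card
      ≤ ((univ.filter fun m : Fin N => m ∉ W' ∧ p m) ∪ (W' \ W)).card := card_le_card hsub
    _ ≤ (univ.filter fun m : Fin N => m ∉ W' ∧ p m).card + (W' \ W).card := card_union_le _ _
    _ = (univ.filter fun m : Fin N => m ∉ W' ∧ p m).card + (W'.card - W.card) := by
        congr 1; omega

/-! ## §2 The structured branch for EVERY read family, slack schedule — unconditional -/

open TwistedJunta36

open scoped Classical in
/-- ★ **THE STRUCTURED BRANCH FOR ARBITRARY OUTSIDE READS — UNCONDITIONAL, SLACK FORM.**  For every `E` there is ONE `θ < 1` such that for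
every `C` there are `D, n₀` with: for `N ≥ n₀`, every tolerance set `W` with `3·#W + 3·(N/(log₂N)^E) ≤ N`, every seed sequence `c` (any
length `R`) graded-spread outside `W` with the SLACK schedule `N/(log₂N)^E + (log₂N)^{2C+E}·(50(j+1) + D·log₂N)`, and every family of juntas
`H k (seed residues) x` reading `T k` with `#(T k ∖ W) ≤ (log₂N)^C` — arbitrary overlaps, multiplicities, co-degrees — the strategy
`x ↦ H k (resVec c x) x` wins the `p = 3` ring game on `≤ θ·2^{N−1}` odd inputs.  No (R1): tolerance enlargement
(`AffBells22.exists_coDegree_tolerance`, threshold `(log₂N)^{2C+E}`, `≤ N/(log₂N)^E` new letters, absorbed by the slack) + the PROVED co-degree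
class `seedJuntaHardXS_of_coDegree` at level `2C + E`, applied to the same seeds and juntas.  (Meaningful for `E ≥ 1`; at `E = 0` the
budget hypothesis is unsatisfiable for `N ≥ 1`.) -/
theorem seedJuntaHardXS_slack (E : ℕ) :
    ∃ θ : ℝ, θ < 1 ∧ ∀ C : ℕ, ∃ D n₀ : ℕ, ∀ N ≥ n₀,
      ∀ (W : Finset (Fin N)) (R : ℕ) (c : Fin R → Fin N → ZMod 3) (T : Fin N → Finset (Fin N))
        (H : Fin N → (Fin R → ZMod 3) → (Fin N → Bool) → Bool),
        3 * W.card + 3 * (N / Nat.log 2 N ^ E) ≤ N →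
        GradedSpreadOff W c (fun j =>
          N / Nat.log 2 N ^ E + (Nat.log 2 N) ^ (2 * C + E) * (50 * (j.val + 1) + D * Nat.log 2 N)) →
        (∀ k, (T k \ W).card ≤ (Nat.log 2 N) ^ C) →
        (∀ k v (x x' : Fin N → Bool), (∀ i ∈ T k, x i = x' i) → H k v x = H k v x') →
          ((univ.filter fun x : Fin N → Bool =>
              OddZeros x ∧ RingHLF.Rel x (fun k => H k (LinForms.resVec c x) x)).card : ℝ)
            ≤ θ * (2 : ℝ) ^ (N - 1) := by
  obtain ⟨θ, hθ, hall⟩ := seedJuntaHardXS_of_coDegree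
  refine ⟨θ, hθ, fun C => ?_⟩
  obtain ⟨D, n₀, hD⟩ := hall (2 * C + E)
  refine ⟨D, max n₀ 4, fun N hN W R c T H hW hspread hT hH => ?_⟩
  have hN0 : n₀ ≤ N := le_trans (le_max_left _ _) hN
  have hN4 : 4 ≤ N := le_trans (le_max_right _ _) hN
  set L : ℕ := Nat.log 2 N with hL
  have hL2 : 2 ≤ L := by
    rw [hL]
    exact Nat.le_log_of_pow_le (by norm_num) (by simpa using hN4)
  have hLpos : 0 < L := by omega
  obtain ⟨W', hWW', hcard, hco⟩ := AffBells22.exists_coDegree_tolerance W T (L ^ (2 * C + E))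
  -- the enlargement adds at most `N/L^E` letters
  have hsum : ∑ k : Fin N, (T k \ W).card * ((T k \ W).card - 1) ≤ N * L ^ (2 * C) := by
    calc ∑ k : Fin N, (T k \ W).card * ((T k \ W).card - 1)
        ≤ ∑ _k : Fin N, L ^ C * L ^ C :=
          sum_le_sum fun k _ => Nat.mul_le_mul (hT k) (le_trans (Nat.sub_le _ _) (hT k))
      _ = N * L ^ (2 * C) := by
          rw [sum_const, card_univ, Fintype.card_fin, smul_eq_mul, ← pow_add, two_mul]
  have hdiff : W'.card - W.card ≤ N / L ^ E := by
    rw [Nat.le_div_iff_mul_le (pow_pos hLpos E)]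
    have h1 : L ^ (2 * C + E) * (W'.card - W.card) ≤ N * L ^ (2 * C) := hcard.trans hsum
    have h2 : L ^ (2 * C) * ((W'.card - W.card) * L ^ E) ≤ L ^ (2 * C) * N := by
      calc L ^ (2 * C) * ((W'.card - W.card) * L ^ E) = L ^ (2 * C + E) * (W'.card - W.card) := by
            rw [pow_add]; ring
        _ ≤ N * L ^ (2 * C) := h1
        _ = L ^ (2 * C) * N := mul_comm _ _
    exact Nat.le_of_mul_le_mul_left h2 (pow_pos hLpos _)
  have hWle : W.card ≤ W'.card := card_le_card hWW'
  have hW' : 3 * W'.card ≤ N := by omega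
  -- the seeds stay graded-spread outside `W'`, with the slack removed
  have hspread' : GradedSpreadOff W' c (fun j => L ^ (2 * C + E) * (50 * (j.val + 1) + D * L)) := by
    intro γ j hj
    have h := hspread γ j hj
    have hmono := card_filter_notMem_le hWW' (fun m : Fin N => ∑ i, γ i * c i m ≠ 0)
    simp only at h hmono ⊢
    omega
  have hT' : ∀ k, (T k \ W').card ≤ L ^ (2 * C + E) := fun k =>
    le_trans (card_le_card (sdiff_subset_sdiff (subset_refl _) hWW'))
      (le_trans (hT k) (Nat.pow_le_pow_right hLpos (by omega)))
  have hco' : ∀ i : Fin N, i ∉ W' →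
      (univ.filter fun i' : Fin N => i' ≠ i ∧ i' ∉ W' ∧ ∃ k, i ∈ T k ∧ i' ∈ T k).card + 1 ≤ L ^ (2 * C + E) :=
    fun i hi => hco i hi
  exact hD N hN0 W' R c T H hW' hspread' hT' hco' hH

end GradedSeeds38

/-! ## §3 The (J3)_{r=1} form: private forms with ANY seed decomposition whose remainders are sparse off `W` -/

namespace LinJunta39

open GradedSeeds38

/-- The value of a decomposed form: `⟨Σ_j a_j c_j + r, x⟩ = Σ_j a_j ⟨c_j, x⟩ + ⟨r, x⟩`. -/
theorem linVal_decomp {N R : ℕ} (c : Fin R → Fin N → ZMod 3) (a : Fin R → ZMod 3) (r ℓ : Fin N → ZMod 3)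
    (hdec : ∀ m, ℓ m = ∑ j, a j * c j m + r m) (x : Fin N → Bool) :
    linVal ℓ x = ∑ j, a j * LinForms.resVec c x j + linVal r x := by
  unfold linVal LinForms.resVec
  have hterm : ∀ m : Fin N, (if x m then ℓ m else 0)
      = ∑ j, a j * (if x m then c j m else 0) + (if x m then r m else 0) := by
    intro m
    by_cases hx : x m
    · simp only [hx, if_true, hdec m]
    · simp [hx]
  rw [sum_congr rfl fun m _ => hterm m, sum_add_distrib, sum_comm]
  congr 1
  exact sum_congr rfl fun j _ => by rw [mul_sum]

/-- **Lemma S relative to `W`, in the (J3) vocabulary.**  For every family of `𝔽₃`-forms `ℓ : Fin K → (Fin N → 𝔽₃)`, every tolerance set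
`W` and every positive schedule `w`: an injective seed sequence `s` with `GradedSpreadOff W (ℓ ∘ s) w`, coefficients `a` and remainders
`r` with `ℓ_k = Σ_j a_{kj} ℓ_{s j} + r_k` and `#(supp r_k ∖ W) < w R` for every `k`. -/
theorem exists_seedDecompositionOff {N K : ℕ} (W : Finset (Fin N)) (ℓ : Fin K → Fin N → ZMod 3)
    (w : ℕ → ℕ) (hw : ∀ n, 0 < w n) :
    ∃ (R : ℕ) (s : Fin R → Fin K) (a : Fin K → Fin R → ZMod 3) (r : Fin K → Fin N → ZMod 3),
      Function.Injective s ∧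
      GradedSpreadOff W (fun j => ℓ (s j)) (fun j => w j.val) ∧
      (∀ k m, ℓ k m = ∑ j, a k j * ℓ (s j) m + r k m) ∧
      ∀ k, (suppOff W (r k)).card < w R := by
  classical
  obtain ⟨R, s, hs, hsp, hrem⟩ := exists_gradedSeedsOff W ℓ w hw
  choose a ha using hrem
  refine ⟨R, s, a, fun k m => ℓ k m - ∑ j, a k j * ℓ (s j) m, hs, ?_, ?_, ?_⟩
  · intro γ j hj
    exact hsp γ j hj.1 hj.2
  · intro k m
    ring
  · intro k
    unfold suppOff
    convert ha k using 2

/-- The slack schedule is positive once `N ≥ 2`; Lemma S relative to `W` with it: seeds graded-spread outside `W` with schedule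
`N/(log₂N)^E + (log₂N)^{2C+E}·(50(j+1) + D·log₂N)` and remainders with `#(supp r_k ∖ W)` below the schedule's value at `R`. -/
theorem exists_seedDecompositionOff_slack (E C D : ℕ) {N K : ℕ} (hN : 2 ≤ N) (W : Finset (Fin N))
    (ℓ : Fin K → Fin N → ZMod 3) :
    ∃ (R : ℕ) (s : Fin R → Fin K) (a : Fin K → Fin R → ZMod 3) (r : Fin K → Fin N → ZMod 3),
      Function.Injective s ∧
      GradedSpreadOff W (fun j => ℓ (s j)) (fun j =>
        N / Nat.log 2 N ^ E + (Nat.log 2 N) ^ (2 * C + E) * (50 * (j.val + 1) + D * Nat.log 2 N)) ∧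
      (∀ k m, ℓ k m = ∑ j, a k j * ℓ (s j) m + r k m) ∧
      ∀ k, (suppOff W (r k)).card
        < N / Nat.log 2 N ^ E + (Nat.log 2 N) ^ (2 * C + E) * (50 * (R + 1) + D * Nat.log 2 N) := by
  have hL1 : 1 ≤ Nat.log 2 N := Nat.le_log_of_pow_le (by norm_num) (by simpa using hN)
  have hw : ∀ n : ℕ, 0 < N / Nat.log 2 N ^ E + (Nat.log 2 N) ^ (2 * C + E) * (50 * (n + 1) + D * Nat.log 2 N) := by
    intro n
    exact Nat.add_pos_right _ (Nat.mul_pos (Nat.one_le_pow _ _ hL1) (by omega))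
  exact exists_seedDecompositionOff W ℓ _ hw

open scoped Classical in
/-- ★ **(J3)_{r=1}, STRUCTURED BRANCH — UNCONDITIONAL FOR EVERY REMAINDER-SUPPORT FAMILY (slack form).**  For every `E`: ONE `θ < 1`,
and for every `C` constants `D, n₀`, such that for `N ≥ n₀`: every private-forms strategy `x ↦ G k (⟨ℓ_k, x⟩ mod 3)` whose forms admit a
decomposition `ℓ_k = Σ_j a_{kj} c_j + r_k` with `c` graded-spread outside a tolerance set `W` (`3·#W + 3·N/(log₂N)^E ≤ N`) under the slack
schedule `N/(log₂N)^E + (log₂N)^{2C+E}·(50(j+1) + D·log₂N)` and `#(supp r_k ∖ W) ≤ (log₂N)^C` for every `k` — the supports otherwise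
ARBITRARY (any overlaps, multiplicities, co-degrees) — wins on `≤ θ·2^{N−1}` odd inputs.  (`seedJuntaHardXS_slack` applied to the
frozen-seed linear bells, which are `(suppOff W r_k ∪ W)`-juntas; with `exists_seedDecompositionOff(_slack)` this is case (A) of the
(J3)_{r=1} dichotomy of ROUND-37 §3.1 relative to any `W`, now free of (R1).) -/
theorem perOutputForms_structured_slack (E : ℕ) :
    ∃ θ : ℝ, θ < 1 ∧ ∀ C : ℕ, ∃ D n₀ : ℕ, ∀ N ≥ n₀,
      ∀ (W : Finset (Fin N)) (ℓ : Fin N → Fin N → ZMod 3) (G : Fin N → ZMod 3 → Bool)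
        (R : ℕ) (c : Fin R → Fin N → ZMod 3) (a : Fin N → Fin R → ZMod 3) (r : Fin N → Fin N → ZMod 3),
        3 * W.card + 3 * (N / Nat.log 2 N ^ E) ≤ N →
        (∀ k m, ℓ k m = ∑ j, a k j * c j m + r k m) →
        GradedSpreadOff W c (fun j =>
          N / Nat.log 2 N ^ E + (Nat.log 2 N) ^ (2 * C + E) * (50 * (j.val + 1) + D * Nat.log 2 N)) →
        (∀ k, (suppOff W (r k)).card ≤ (Nat.log 2 N) ^ C) →
          ((univ.filter fun x : Fin N → Bool =>
              OddZeros x ∧ RingHLF.Rel x (fun k => G k (linVal (ℓ k) x))).card : ℝ)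
            ≤ θ * (2 : ℝ) ^ (N - 1) := by
  obtain ⟨θ, hθ, hall⟩ := seedJuntaHardXS_slack E
  refine ⟨θ, hθ, fun C => ?_⟩
  obtain ⟨D, n₀, hD⟩ := hall C
  refine ⟨D, n₀, fun N hN W ℓ G R c a r hW hdec hspread hr => ?_⟩
  -- the frozen-seed linear bells are `(suppOff W r_k ∪ W)`-juntas
  have hT : ∀ k, ((suppOff W (r k) ∪ W) \ W).card ≤ (Nat.log 2 N) ^ C := fun k =>
    (card_le_card (sdiff_suppOff_union_subset W (r k))).trans (hr k)
  have hH : ∀ k (v : Fin R → ZMod 3) (x x' : Fin N → Bool), (∀ i ∈ suppOff W (r k) ∪ W, x i = x' i) →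
      G k (∑ j, a k j * v j + linVal (r k) x) = G k (∑ j, a k j * v j + linVal (r k) x') :=
    fun k v x x' hxx' => by rw [linVal_readsOnly W (r k) x x' hxx']
  have h := hD N hN W R c (fun k => suppOff W (r k) ∪ W) (fun k v x => G k (∑ j, a k j * v j + linVal (r k) x))
    hW hspread hT hH
  have hlin : ∀ (k : Fin N) (x : Fin N → Bool),
      linVal (ℓ k) x = ∑ j, a k j * LinForms.resVec c x j + linVal (r k) x :=
    fun k x => linVal_decomp c (a k) (r k) (ℓ k) (hdec k) x
  have hset : (univ.filter fun x : Fin N → Bool => OddZeros x ∧ RingHLF.Rel x (fun k => G k (linVal (ℓ k) x)))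
      = univ.filter fun x : Fin N → Bool =>
          OddZeros x ∧ RingHLF.Rel x (fun k => G k (∑ j, a k j * LinForms.resVec c x j + linVal (r k) x)) := by
    refine filter_congr fun x _ => ?_
    simp only [hlin]
  rw [hset]
  exact h

end LinJunta39

end Summit.QuantumAdvantage.AdviceFreeQNC0

end
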